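import Literature.Combinatorics.Enumerative.BesselPolynomials
import Mathlib
import HarnessLib

/-!
# The recurrence relations of the Bessel polynomials (Krall–Frink 1949, §2 and §7 (21))

H. L. Krall, O. Frink, *A new class of orthogonal polynomials: the Bessel polynomials*, Trans. Amer. Math. Soc. 65 (1949)
100–115, §2 (p. 101) and §7 "Recurrence relations for the Bessel polynomials", display (21) (p. 105).  Source (VERBATIM,
held text `paper:doi-10-1090-s0002-9947-1949-0028473-1`, pages 2 and 6; the OCR of the displays is damaged, the two
relations used here are legible):

> [§2] `y_0(x) = 1, y_1(x) = 1 + x, y_2(x) = 1 + 3x + 3x², y_3(x) = 1 + 6x + 15x² + 15x³, y_4(x) = 1 + 10x + 45x² + 105x³ + 105x⁴,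
> y_5(x) = 1 + 15x + 105x² + 420x³ + 945x⁴ + 945x⁵`. These polynomials may be readily obtained from the recurrence relation:
> `y_{n+1} = (2n+1) x y_n + y_{n−1}`.
> [§7] Among the infinitely many recurrence relations for the Bessel polynomials, we list the following five as being the
> most useful or interesting. […] `y_{n+1} = (2n+1) x y_n + y_{n−1}`,  `x² y_n' = (nx − 1) y_n + y_{n−1}`, […] (21)

## What is formalised (`y_n` = the tree's `besselPolynomial R n`, `a(n,k) = [x^k] y_n` = `besselCoeff n k = {n+k \brace n}_{≤2}`)

* the coefficient recurrences `a(n+2,k+1) = (2n+3)·a(n+1,k) + a(n,k+1)` and `a(n+1,k+1) + k·a(n+1,k) = (n+1)·a(n+1,k) + a(n,k+1)`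
  (from the division-free closed form `(n−k)!·2^k·k!·a(n,k) = (n+k)!` of the tree);
* **the three-term recurrence `y_{n+2} = (2n+3)·x·y_{n+1} + y_n`** (the first relation of (21), index shifted by one so that
  no `y_{−1}` is needed) and **`x²·y_{n+1}' = ((n+1)x − 1)·y_{n+1} + y_n`** (the second relation of (21)), over any commutative
  ring; the printed table `y_0, …, y_5`.

## References
* [KrallFrink1949] H. L. Krall, O. Frink, *A new class of orthogonal polynomials: the Bessel polynomials*, Trans. Amer. Math.
  Soc. 65 (1949) 100–115, §2 p. 101 and §7 (21) p. 105.
-/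

namespace Literature.Combinatorics.Enumerative.BesselPolynomialRecurrences

open Finset Polynomial RestrictedStirlingNumbersSecondKind BesselPolynomials
open scoped Nat

/-! ### Coefficient recurrences -/

/-- `a(n,0) = 1` (`y_n(0) = 1`). [cite: KrallFrink1949, §2 (the table `y_0, …, y_5`), p. 101] -/
theorem besselCoeff_zero (n : ℕ) : besselCoeff n 0 = 1 := by
  rw [besselCoeff_eq, add_zero, restrictedStirlingSecond_self two_ne_zero]

/-- **`a(n+2,k+1) = (2n+3)·a(n+1,k) + a(n,k+1)`** — the coefficient of `x^{k+1}` in `y_{n+2} = (2n+3) x y_{n+1} + y_n`.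
[cite: KrallFrink1949, §7 (21) (first relation), p. 105] -/
theorem besselCoeff_succ_succ (n k : ℕ) :
    besselCoeff (n + 2) (k + 1) = (2 * n + 3) * besselCoeff (n + 1) k + besselCoeff n (k + 1) := by
  rcases Nat.lt_or_ge n (k + 1) with h | h
  · -- `n ≤ k`: the last term vanishes
    rw [besselCoeff_eq_zero_of_lt h, add_zero]
    rcases Nat.lt_or_ge (n + 1) k with h' | h'
    · rw [besselCoeff_eq_zero_of_lt (by omega : n + 2 < k + 1), besselCoeff_eq_zero_of_lt h', mul_zero]
    · obtain rfl | rfl : n = k ∨ n + 1 = k := by omega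
      · -- `k = n`: `a(n+2,n+1) = (2n+3)·a(n+1,n)`
        have h1 : 2 ^ (n + 1) * (n + 1)! * besselCoeff (n + 2) (n + 1) = (2 * n + 3)! := by
          have h0 := factorial_mul_besselCoeff (show n + 1 ≤ n + 2 by omega)
          rwa [show n + 2 - (n + 1) = 1 by omega, Nat.factorial_one, one_mul, show n + 2 + (n + 1) = 2 * n + 3 by ring] at h0
        have h2 : 2 ^ n * n ! * besselCoeff (n + 1) n = (2 * n + 1)! := by
          have h0 := factorial_mul_besselCoeff (show n ≤ n + 1 by omega)
          rwa [show n + 1 - n = 1 by omega, Nat.factorial_one, one_mul, show n + 1 + n = 2 * n + 1 by ring] at h0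
        apply Nat.eq_of_mul_eq_mul_left (show 0 < 2 ^ (n + 1) * (n + 1)! by positivity)
        rw [h1, show 2 * n + 3 = (2 * n + 1) + 1 + 1 from rfl, Nat.factorial_succ (2 * n + 1 + 1), Nat.factorial_succ (2 * n + 1),
          ← h2, pow_succ, Nat.factorial_succ n]
        ring
      · -- `k = n + 1`: `a(n+2,n+2) = (2n+3)·a(n+1,n+1)`
        have h1 : 2 ^ (n + 2) * (n + 2)! * besselCoeff (n + 2) (n + 1 + 1) = (2 * n + 4)! := by
          have h0 := factorial_mul_besselCoeff (le_refl (n + 2))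
          rw [Nat.sub_self, Nat.factorial_zero, one_mul, show n + 2 + (n + 2) = 2 * n + 4 by ring] at h0
          exact h0
        have h2 : 2 ^ (n + 1) * (n + 1)! * besselCoeff (n + 1) (n + 1) = (2 * n + 2)! := by
          have h0 := factorial_mul_besselCoeff (le_refl (n + 1))
          rwa [Nat.sub_self, Nat.factorial_zero, one_mul, show n + 1 + (n + 1) = 2 * n + 2 by ring] at h0
        apply Nat.eq_of_mul_eq_mul_left (show 0 < 2 ^ (n + 2) * (n + 2)! by positivity)
        rw [h1, show 2 * n + 4 = (2 * n + 2) + 1 + 1 from rfl, Nat.factorial_succ (2 * n + 2 + 1), Nat.factorial_succ (2 * n + 2),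
          ← h2, pow_succ 2 (n + 1), Nat.factorial_succ (n + 1)]
        ring
  · -- `k + 1 ≤ n = k + 1 + d`: all three coefficients are nonzero
    obtain ⟨d, rfl⟩ : ∃ d, n = k + 1 + d := ⟨n - (k + 1), by omega⟩
    have h1 : (d + 2)! * 2 ^ (k + 1) * (k + 1)! * besselCoeff (k + 1 + d + 2) (k + 1) = (2 * k + d + 4)! := by
      have h0 := factorial_mul_besselCoeff (show k + 1 ≤ k + 1 + d + 2 by omega)
      rwa [show k + 1 + d + 2 - (k + 1) = d + 2 by omega, show k + 1 + d + 2 + (k + 1) = 2 * k + d + 4 by ring] at h0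
    have h2 : (d + 2)! * 2 ^ k * k ! * besselCoeff (k + 1 + d + 1) k = (2 * k + d + 2)! := by
      have h0 := factorial_mul_besselCoeff (show k ≤ k + 1 + d + 1 by omega)
      rwa [show k + 1 + d + 1 - k = d + 2 by omega, show k + 1 + d + 1 + k = 2 * k + d + 2 by ring] at h0
    have h3 : d ! * 2 ^ (k + 1) * (k + 1)! * besselCoeff (k + 1 + d) (k + 1) = (2 * k + d + 2)! := by
      have h0 := factorial_mul_besselCoeff (show k + 1 ≤ k + 1 + d by omega)
      rwa [show k + 1 + d - (k + 1) = d by omega, show k + 1 + d + (k + 1) = 2 * k + d + 2 by ring] at h0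
    rw [show d + 2 = d + 1 + 1 from rfl, Nat.factorial_succ (d + 1), Nat.factorial_succ d] at h1 h2
    rw [pow_succ, Nat.factorial_succ k] at h1 h3
    set A1 := besselCoeff (k + 1 + d + 2) (k + 1)
    set A2 := besselCoeff (k + 1 + d + 1) k
    set A3 := besselCoeff (k + 1 + d) (k + 1)
    rw [show 2 * k + d + 4 = (2 * k + d + 2) + 1 + 1 from rfl, Nat.factorial_succ (2 * k + d + 2 + 1),
      Nat.factorial_succ (2 * k + d + 2)] at h1
    set M := (2 * k + d + 2)!
    apply Nat.eq_of_mul_eq_mul_left (show 0 < (d + 1 + 1) * ((d + 1) * d !) * (2 ^ k * 2) * ((k + 1) * k !) by positivity)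
    zify at h1 h2 h3 ⊢
    linear_combination h1 - (2 * ((k : ℤ) + 1) * (2 * ((k : ℤ) + 1 + d) + 3)) * h2 - (((d : ℤ) + 2) * ((d : ℤ) + 1)) * h3

/-- **`a(n+1,k+1) + k·a(n+1,k) = (n+1)·a(n+1,k) + a(n,k+1)`** (i.e. `a(n+1,k+1) = (n+1−k)·a(n+1,k) + a(n,k+1)`) — the
coefficient of `x^{k+1}` in `x² y_{n+1}' = ((n+1)x − 1) y_{n+1} + y_n`. [cite: KrallFrink1949, §7 (21) (second relation), p. 105] -/
theorem besselCoeff_succ_add (n k : ℕ) :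
    besselCoeff (n + 1) (k + 1) + k * besselCoeff (n + 1) k = (n + 1) * besselCoeff (n + 1) k + besselCoeff n (k + 1) := by
  rcases Nat.lt_or_ge n k with h | h
  · -- `n < k`
    rw [besselCoeff_eq_zero_of_lt (by omega : n + 1 < k + 1), besselCoeff_eq_zero_of_lt (by omega : n < k + 1), zero_add,
      add_zero]
    rcases Nat.lt_or_ge (n + 1) k with h' | h'
    · rw [besselCoeff_eq_zero_of_lt h', mul_zero, mul_zero]
    · obtain rfl : k = n + 1 := by omega
      rfl
  · obtain ⟨d, rfl⟩ : ∃ d, n = k + d := ⟨n - k, by omega⟩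
    rcases d with _ | d
    · -- `k = n`: `a(n+1,n+1) = a(n+1,n)` and `a(n,n+1) = 0`
      rw [add_zero, besselCoeff_eq_zero_of_lt (Nat.lt_succ_self k), add_zero]
      have h1 : 2 ^ (k + 1) * (k + 1)! * besselCoeff (k + 1) (k + 1) = (2 * k + 2)! := by
        have h0 := factorial_mul_besselCoeff (le_refl (k + 1))
        rwa [Nat.sub_self, Nat.factorial_zero, one_mul, show k + 1 + (k + 1) = 2 * k + 2 by ring] at h0
      have h2 : 2 ^ k * k ! * besselCoeff (k + 1) k = (2 * k + 1)! := by
        have h0 := factorial_mul_besselCoeff (show k ≤ k + 1 by omega)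
        rwa [show k + 1 - k = 1 by omega, Nat.factorial_one, one_mul, show k + 1 + k = 2 * k + 1 by ring] at h0
      have he : besselCoeff (k + 1) (k + 1) = besselCoeff (k + 1) k := by
        apply Nat.eq_of_mul_eq_mul_left (show 0 < 2 ^ (k + 1) * (k + 1)! by positivity)
        rw [h1, show 2 * k + 2 = (2 * k + 1) + 1 from rfl, Nat.factorial_succ (2 * k + 1), ← h2, pow_succ, Nat.factorial_succ k]
        ring
      rw [he]
      ring
    · -- `n = k + d + 1`, `d ≥ 0`: three nonzero coefficients
      have h1 : (d + 1)! * 2 ^ (k + 1) * (k + 1)! * besselCoeff (k + (d + 1) + 1) (k + 1) = (2 * k + d + 3)! := by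
        have h0 := factorial_mul_besselCoeff (show k + 1 ≤ k + (d + 1) + 1 by omega)
        rwa [show k + (d + 1) + 1 - (k + 1) = d + 1 by omega, show k + (d + 1) + 1 + (k + 1) = 2 * k + d + 3 by ring] at h0
      have h2 : (d + 2)! * 2 ^ k * k ! * besselCoeff (k + (d + 1) + 1) k = (2 * k + d + 2)! := by
        have h0 := factorial_mul_besselCoeff (show k ≤ k + (d + 1) + 1 by omega)
        rwa [show k + (d + 1) + 1 - k = d + 2 by omega, show k + (d + 1) + 1 + k = 2 * k + d + 2 by ring] at h0
      have h3 : d ! * 2 ^ (k + 1) * (k + 1)! * besselCoeff (k + (d + 1)) (k + 1) = (2 * k + d + 2)! := by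
        have h0 := factorial_mul_besselCoeff (show k + 1 ≤ k + (d + 1) by omega)
        rwa [show k + (d + 1) - (k + 1) = d by omega, show k + (d + 1) + (k + 1) = 2 * k + d + 2 by ring] at h0
      rw [Nat.factorial_succ d] at h1
      rw [pow_succ, Nat.factorial_succ k] at h1 h3
      rw [show d + 2 = d + 1 + 1 from rfl, Nat.factorial_succ (d + 1), Nat.factorial_succ d] at h2
      set A1 := besselCoeff (k + (d + 1) + 1) (k + 1)
      set A2 := besselCoeff (k + (d + 1) + 1) k
      set A3 := besselCoeff (k + (d + 1)) (k + 1)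
      rw [show 2 * k + d + 3 = (2 * k + d + 2) + 1 from rfl, Nat.factorial_succ (2 * k + d + 2)] at h1
      set M := (2 * k + d + 2)!
      apply Nat.eq_of_mul_eq_mul_left (show 0 < (d + 1 + 1) * ((d + 1) * d !) * (2 ^ k * 2) * ((k + 1) * k !) by positivity)
      zify at h1 h2 h3 ⊢
      linear_combination ((d : ℤ) + 2) * h1 - (2 * ((k : ℤ) + 1) * ((d : ℤ) + 2)) * h2 - (((d : ℤ) + 2) * ((d : ℤ) + 1)) * h3

/-! ### The polynomial recurrences -/

section Ring

variable (R : Type*) [CommRing R]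

/-- **`y_{n+2} = (2n+3)·x·y_{n+1} + y_n`** (Krall–Frink's `y_{n+1} = (2n+1)x y_n + y_{n−1}`, `n ↦ n+1`).
[cite: KrallFrink1949, §7 (21) (first relation), p. 105; §2, p. 101] -/
theorem besselPolynomial_succ_succ (n : ℕ) :
    besselPolynomial R (n + 2) = C (((2 * n + 3 : ℕ) : R)) * X * besselPolynomial R (n + 1) + besselPolynomial R n := by
  ext k
  rw [coeff_add, coeff_besselPolynomial, coeff_besselPolynomial, mul_assoc, coeff_C_mul]
  rcases k with _ | k
  · rw [coeff_X_mul_zero, mul_zero, zero_add, besselCoeff_zero, besselCoeff_zero]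
  · rw [coeff_X_mul, coeff_besselPolynomial, besselCoeff_succ_succ]
    push_cast
    ring

/-- **`x²·y_{n+1}' = ((n+1)x − 1)·y_{n+1} + y_n`** (Krall–Frink's `x² y_n' = (nx − 1) y_n + y_{n−1}`, `n ↦ n+1`).
[cite: KrallFrink1949, §7 (21) (second relation), p. 105] -/
theorem X_sq_mul_derivative_besselPolynomial (n : ℕ) :
    X ^ 2 * derivative (besselPolynomial R (n + 1)) =
      (C (((n + 1 : ℕ) : R)) * X - 1) * besselPolynomial R (n + 1) + besselPolynomial R n := by
  ext k
  rw [coeff_X_pow_mul', coeff_add, sub_mul, one_mul, coeff_sub, mul_assoc, coeff_C_mul, coeff_besselPolynomial,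
    coeff_besselPolynomial]
  rcases k with _ | k
  · rw [if_neg (by omega), coeff_X_mul_zero, mul_zero, zero_sub, besselCoeff_zero, besselCoeff_zero]
    push_cast
    ring
  · rw [coeff_X_mul, coeff_besselPolynomial]
    have hid := besselCoeff_succ_add n k
    have hL : (if 2 ≤ k + 1 then (derivative (besselPolynomial R (n + 1))).coeff (k + 1 - 2) else 0) =
        (k : R) * (besselCoeff (n + 1) k : ℕ) := by
      rcases k with _ | k
      · rw [if_neg (by omega), Nat.cast_zero, zero_mul]
      · rw [if_pos (by omega), show k + 1 + 1 - 2 = k by omega, coeff_derivative, coeff_besselPolynomial]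
        push_cast
        ring
    rw [hL]
    have hid' := congrArg (Nat.cast : ℕ → R) hid
    push_cast at hid' ⊢
    linear_combination hid'

/-- The printed table: `y_2 = 1 + 3x + 3x²`, `y_3 = 1 + 6x + 15x² + 15x³`, `y_4 = 1 + 10x + 45x² + 105x³ + 105x⁴`,
`y_5 = 1 + 15x + 105x² + 420x³ + 945x⁴ + 945x⁵` (coefficient lists). [cite: KrallFrink1949, §2 (the table below (3)), p. 101] -/
theorem besselCoeff_table :
    (List.range 6).map (fun n => (List.range (n + 1)).map (besselCoeff n)) =
      [[1], [1, 1], [1, 3, 3], [1, 6, 15, 15], [1, 10, 45, 105, 105], [1, 15, 105, 420, 945, 945]] := by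
  decide

end Ring

end Literature.Combinatorics.Enumerative.BesselPolynomialRecurrences
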